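/-
Copyright (c) 2026 the pub-hodgecm-mathlib formalisation cell (harness21).  Prover seat hodgecm-mathlib-K2E1-p10 (g2), Track B ∕ K2-LIT (build stream 29), h413 = `stmt-HodgeConjecture-24833`,
route of record `HCCMUnconditional`, ROADCARD «5Res ENDGAME BY FAMILIES» §2 C7; dealer K2E1-plan (g7) deal (155) 2026-09-04T11:45:34Z («C7 (a): the K-average of θ_Φ is θ of the
K-average, so E^{K} = closure span of the K-invariant pseudo-Eisenstein series») — FILE F1 of the C7 split: the ABSTRACT K-AVERAGING PROJECTOR.
-/
import Literature.NumberTheory.Automorphic.HilbertRepSpectrum      -- ★ `ContRepresentation.IsUnitary`, `IsStronglyContinuous`, `ClosedSubrep`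
import Mathlib.MeasureTheory.Integral.Bochner.ContinuousLinearMap
import Mathlib.MeasureTheory.Group.Integral
import Mathlib.Analysis.Convex.Integral
import HarnessLib

/-!
# h413 ∕ Track B «K2-LIT», ROADCARD «5Res BY FAMILIES» C7, FILE F1 — helper `K2E1KAverageProjectionU`: THE `K`-AVERAGE `v ↦ ∫_K π(ι k) v dk` OF A UNITARY REPRESENTATION
# IS A CONTRACTION ONTO THE `K`-FIXED VECTORS PRESERVING CLOSED INVARIANT SUBSPACES, HENCE `E ∩ H^{K} = closure span {∫_K π(ι k) s dk : s ∈ S}` WHENEVER `E = closure span S`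

Cell `pub/hodgecm-mathlib`, crux h413 = `stmt-HodgeConjecture-24833`, route of record `HCCMUnconditional`; dealer K2E1-plan (g7) (155), ROADCARD §2 C7 (a).  THEOREMS ONLY (no `def`, no
`instance`, no notation, no named-fact hypothesis, no `sorry`); lane `--supports stmt-HodgeConjecture-24833 --as helper` (count-neutral).  Closes no socket.  ABSTRACT and GROUP-FREE:
`π` any unitary `ContRepresentation` of a group `G` on a complex Hilbert space `H`; `K` any topological group with a left-invariant PROBABILITY measure `μK` (a compact group and
its normalised Haar measure) and a homomorphism `ι : K →* G` along which `π` is strongly continuous (`(π.restrict ι).IsStronglyContinuous`).  The average is written as the Bochner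
integral `∫ k, π (ι k) v ∂μK` throughout (no definition is introduced); `(π.restrict ι).invariants` (Mathlib) is the closed subspace `H^{K}` of `K`-fixed vectors.

WHY (ROADCARD §0–§2, C7 (a)).  `E := (L²_cusp)ᗮ = closure span {[θ_Φ]}` (★ f1 `cmCuspidalSubspace_orthogonal_eq_topologicalClosure_span_two`); the trivial-`K`-type part `E^{K} = E ∩ H^{K}`
that T9′∕C9 decompose is, by this file, `closure span {P_K [θ_Φ]}` with `P_K v = ∫_K R(ι k) v dk`; FILE F2 identifies `P_K [θ_Φ] = [θ_{Φ^♮}]`, `Φ^♮ = ∫_K Φ(ι k ·) dk`, so that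
`E^{K} = closure span {[θ_Φ] : Φ left-K-invariant}`, and FILE F3 splits the `K`-invariant `Φ` along the compact abelian `Y¹` into families.

* §1 `integrable_apply`, `average_eq_self_of_forall_apply_eq`, `apply_average_eq`, `average_mem_invariants`, `average_mem` (closed invariant subspaces, Mathlib
  `Convex.integral_mem`), `norm_average_le`, `average_add`, `average_smul`, `exists_clm_average` (the average as a bounded operator), `isClosed_invariants_restrict`.
* §2 **`inf_invariants_eq_topologicalClosure_span_image_average`**: `E ⊓ H^{K} = closure span {∫ π(ι k) s dk : s ∈ S}` for `E` closed `π`-stable with `S ⊆ E ⊆ closure span S`;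
  and the membership form **`mem_topologicalClosure_span_image_average`** (T9′'s `∀ k, π (ι k) v = v` currency).

HONEST LABEL: HC_CM is proved only modulo the 7 printed citations (2 remaining named inputs: hLiu418 = `stmt-HodgeConjecture-24832`, h413 = `stmt-HodgeConjecture-24833`) until rung 0
closes; this file asserts no named fact and closes no socket.
References: [DeitmarEchterhoff2014] A. Deitmar, S. Echterhoff, *Principles of Harmonic Analysis*, 2nd ed., Lemma 1.6.3, Prop. 6.2.1, Lemma 7.2.6 (the projector `P_K = π(𝟙_K)`);
[BorelJacquet1979] A. Borel, H. Jacquet, *Automorphic forms and automorphic representations*, §4.6; [MoeglinWaldspurger1995] C. Mœglin, J.-L. Waldspurger, *Spectral Decomposition and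
Eisenstein Series*, II.1.2–II.1.4; [Folland1999] G. B. Folland, *Real Analysis*, Prop. 2.35, Thm. 2.27.
-/

set_option autoImplicit false
-- the mandated namespace repeats `HodgeConjecture.HodgeConjecture`, as in every `Theorems/*.lean` of this sub-problem
set_option linter.dupNamespace false

noncomputable section

open MeasureTheory Set Filter Topology
open scoped InnerProductSpace

namespace Summit.HodgeConjecture.HodgeConjecture.Cruxes.H413.K2E1KAverageProjectionU

variable {G : Type*} [Group G] {H : Type*} [NormedAddCommGroup H] [InnerProductSpace ℂ H] [CompleteSpace H] {π : ContRepresentation ℂ G H} {K : Type*} [Group K] (ι : K →* G)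

/-! ## §1 The `K`-average `∫_K π(ι k) v dk`: fixed vectors, contraction, integrability, membership, linearity, invariance -/

omit [CompleteSpace H] in
/-- The fixed-vector submodule `H^{K} = (π.restrict ι).invariants` is closed (an intersection of equalisers of continuous maps). [folklore] -/
theorem isClosed_invariants_restrict : IsClosed ((π.restrict ι).invariants : Set H) := by
  have h : ((π.restrict ι).invariants : Set H) = ⋂ k : K, {v : H | π (ι k) v = v} := by
    ext v
    simp only [SetLike.mem_coe, ContRepresentation.mem_invariants, ContRepresentation.restrict_apply_apply, mem_iInter, mem_setOf_eq]
  rw [h]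
  exact isClosed_iInter fun k => isClosed_eq (π (ι k)).continuous continuous_id

section Probability

variable [MeasurableSpace K] (μK : Measure K) [IsProbabilityMeasure μK]

/-- **A `K`-FIXED VECTOR IS ITS OWN AVERAGE**: `∫_K π(ι k) v dk = v` when `π(ι k) v = v` for all `k` (`μK` a probability measure). [cite: DeitmarEchterhoff2014, Lemma 7.2.6] -/
theorem average_eq_self_of_forall_apply_eq {v : H} (hv : ∀ k, π (ι k) v = v) : ∫ k, π (ι k) v ∂μK = v := by
  rw [show (fun k => π (ι k) v) = fun _ => v from funext hv, integral_const, probReal_univ, one_smul]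

/-- **THE AVERAGE IS A CONTRACTION**: `‖∫_K π(ι k) v dk‖ ≤ ‖v‖`. [cite: DeitmarEchterhoff2014, Prop. 6.2.1] -/
theorem norm_average_le (hu : π.IsUnitary) (v : H) : ‖∫ k, π (ι k) v ∂μK‖ ≤ ‖v‖ :=
  calc ‖∫ k, π (ι k) v ∂μK‖ ≤ ∫ _, ‖v‖ ∂μK := norm_integral_le_of_norm_le (integrable_const ‖v‖) (Eventually.of_forall fun k => (hu.norm_map (ι k) v).le)
    _ = ‖v‖ := by rw [integral_const, probReal_univ, one_smul]

omit [CompleteSpace H] [IsProbabilityMeasure μK] in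
/-- Homogeneity of the average. [folklore] -/
theorem average_smul (c : ℂ) (v : H) : ∫ k, π (ι k) (c • v) ∂μK = c • ∫ k, π (ι k) v ∂μK := by
  simp only [map_smul]
  exact integral_smul c _

variable [TopologicalSpace K] [BorelSpace K] [SecondCountableTopology K]

/-- The orbit `k ↦ π(ι k) v` is Bochner integrable on the probability space `(K, μK)` (continuous, of constant norm `‖v‖`). [cite: DeitmarEchterhoff2014, Prop. 6.2.1] -/
theorem integrable_apply (hu : π.IsUnitary) (hc : (π.restrict ι).IsStronglyContinuous) (v : H) : Integrable (fun k => π (ι k) v) μK :=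
  (integrable_const ‖v‖).mono' (hc v).aestronglyMeasurable (Eventually.of_forall fun k => (hu.norm_map (ι k) v).le)

/-- **THE AVERAGE STAYS IN EVERY CLOSED INVARIANT SUBSPACE** (a closed convex set containing the integrand a.e., probability measure: Mathlib `Convex.integral_mem`). [cite: DeitmarEchterhoff2014, §9.2] -/
theorem average_mem (hu : π.IsUnitary) (hc : (π.restrict ι).IsStronglyContinuous) (W : ContRepresentation.ClosedSubrep π) {v : H} (hv : v ∈ W) : (∫ k, π (ι k) v ∂μK) ∈ W :=
  (W.toSubmodule.restrictScalars ℝ).convex.integral_mem W.isClosed (Eventually.of_forall fun k => W.apply_mem (ι k) hv) (integrable_apply ι μK hu hc v)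

/-- Additivity of the average. [folklore] -/
theorem average_add (hu : π.IsUnitary) (hc : (π.restrict ι).IsStronglyContinuous) (v w : H) :
    ∫ k, π (ι k) (v + w) ∂μK = (∫ k, π (ι k) v ∂μK) + ∫ k, π (ι k) w ∂μK := by
  simp only [map_add]
  exact integral_add (integrable_apply ι μK hu hc v) (integrable_apply ι μK hu hc w)

/-- **THE AVERAGE AS A BOUNDED OPERATOR** `P : H →L[ℂ] H`, `P v = ∫_K π(ι k) v dk`, `‖P‖ ≤ 1` (no definition is introduced: an existential). [cite: DeitmarEchterhoff2014, Prop. 6.2.1] -/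
theorem exists_clm_average (hu : π.IsUnitary) (hc : (π.restrict ι).IsStronglyContinuous) : ∃ P : H →L[ℂ] H, ∀ v, P v = ∫ k, π (ι k) v ∂μK :=
  ⟨LinearMap.mkContinuous { toFun := fun v => ∫ k, π (ι k) v ∂μK, map_add' := average_add ι μK hu hc, map_smul' := average_smul ι μK } 1
      fun v => by rw [one_mul]; exact norm_average_le ι μK hu v,
    fun _ => rfl⟩

variable [IsTopologicalGroup K] [μK.IsMulLeftInvariant]

/-- **THE AVERAGE IS `K`-FIXED**: `π(ι k₀) ∫_K π(ι k) v dk = ∫_K π(ι (k₀k)) v dk = ∫_K π(ι k) v dk` (the operator commutes with the Bochner integral; `μK` is left-invariant).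
[cite: DeitmarEchterhoff2014, Lemma 7.2.6] -/
theorem apply_average_eq (hu : π.IsUnitary) (hc : (π.restrict ι).IsStronglyContinuous) (v : H) (k₀ : K) :
    π (ι k₀) (∫ k, π (ι k) v ∂μK) = ∫ k, π (ι k) v ∂μK := by
  rw [← (π (ι k₀)).integral_comp_comm (integrable_apply ι μK hu hc v)]
  have h : (fun k => π (ι k₀) (π (ι k) v)) = fun k => π (ι (k₀ * k)) v := funext fun k => by rw [map_mul, map_mul]; rfl
  rw [h]
  exact integral_mul_left_eq_self (fun k => π (ι k) v) k₀

/-- The average lies in the fixed-vector submodule `H^{K} = (π.restrict ι).invariants`. [cite: DeitmarEchterhoff2014, Lemma 7.2.6] -/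
theorem average_mem_invariants (hu : π.IsUnitary) (hc : (π.restrict ι).IsStronglyContinuous) (v : H) : (∫ k, π (ι k) v ∂μK) ∈ (π.restrict ι).invariants :=
  fun k₀ => apply_average_eq ι μK hu hc v k₀

/-! ## §2 `E ∩ H^{K}` is the closed span of the averages of a spanning set of `E` -/

/-- **`E ∩ H^{K} = closure span {∫_K π(ι k) s dk : s ∈ S}`** for a closed `π`-stable `E` and any `S ⊆ E` with `E ≤ closure (span S)`: `⊇` — each average lies in `E` (`average_mem`) and in
`H^{K}` (`average_mem_invariants`), both closed; `⊆` — a fixed `v ∈ E` is its own average, the average is a bounded operator `P`, and `P (closure (span S)) ⊆ closure (P (span S)) ⊆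
closure (span (P '' S))`. [cite: DeitmarEchterhoff2014, Lemma 7.2.6] [cite: MoeglinWaldspurger1995, II.1.2] -/
theorem inf_invariants_eq_topologicalClosure_span_image_average (hu : π.IsUnitary) (hc : (π.restrict ι).IsStronglyContinuous) (E : ContRepresentation.ClosedSubrep π)
    {S : Set H} (hSE : S ⊆ E) (hES : E.toSubmodule ≤ (Submodule.span ℂ S).topologicalClosure) :
    E.toSubmodule ⊓ (π.restrict ι).invariants = (Submodule.span ℂ ((fun s => ∫ k, π (ι k) s ∂μK) '' S)).topologicalClosure := by
  obtain ⟨P, hP⟩ := exists_clm_average ι μK hu hc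
  have hPS : (fun s => ∫ k, π (ι k) s ∂μK) '' S = P '' S := image_congr fun s _ => (hP s).symm
  refine le_antisymm ?_ ?_
  · rintro v ⟨hvE, hvK⟩
    have hv : v = P v := by rw [hP, average_eq_self_of_forall_apply_eq ι μK fun k => hvK k]
    have hvc : v ∈ closure (Submodule.span ℂ S : Set H) := by rw [← Submodule.topologicalClosure_coe]; exact hES hvE
    have h1 : P v ∈ closure (P '' (Submodule.span ℂ S : Set H)) := image_closure_subset_closure_image P.continuous ⟨v, hvc, rfl⟩
    have hle : Submodule.span ℂ S ≤ (Submodule.span ℂ (P '' S)).comap (P : H →ₗ[ℂ] H) := Submodule.span_le.2 fun s hs => Submodule.subset_span ⟨s, hs, rfl⟩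
    have h2 : P '' (Submodule.span ℂ S : Set H) ⊆ (Submodule.span ℂ (P '' S) : Set H) := by
      rintro _ ⟨w, hw, rfl⟩
      exact hle hw
    rw [hv, hPS]
    show P v ∈ ((Submodule.span ℂ (P '' S)).topologicalClosure : Set H)
    rw [Submodule.topologicalClosure_coe]
    exact closure_mono h2 h1
  · refine Submodule.topologicalClosure_minimal _ (Submodule.span_le.2 ?_) (E.isClosed.inter (isClosed_invariants_restrict ι))
    rintro _ ⟨s, hs, rfl⟩
    exact ⟨average_mem ι μK hu hc E (hSE hs), average_mem_invariants ι μK hu hc s⟩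

/-- **MEMBERSHIP FORM** (T9′'s `∀ k, R(ι k) v = v` currency): a `K`-fixed `v ∈ E` lies in the closed span of the averages of `S`. [cite: DeitmarEchterhoff2014, Lemma 7.2.6] -/
theorem mem_topologicalClosure_span_image_average (hu : π.IsUnitary) (hc : (π.restrict ι).IsStronglyContinuous) (E : ContRepresentation.ClosedSubrep π)
    {S : Set H} (hSE : S ⊆ E) (hES : E.toSubmodule ≤ (Submodule.span ℂ S).topologicalClosure) {v : H} (hv : v ∈ E) (hfix : ∀ k, π (ι k) v = v) :
    v ∈ (Submodule.span ℂ ((fun s => ∫ k, π (ι k) s ∂μK) '' S)).topologicalClosure := by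
  rw [← inf_invariants_eq_topologicalClosure_span_image_average ι μK hu hc E hSE hES]
  exact ⟨hv, fun k => hfix k⟩

/-- **CONVERSELY** each average `∫_K π(ι k) s dk`, `s ∈ E`, is a `K`-fixed vector of `E`. [cite: DeitmarEchterhoff2014, Lemma 7.2.6] -/
theorem average_mem_and_forall_apply_eq (hu : π.IsUnitary) (hc : (π.restrict ι).IsStronglyContinuous) (E : ContRepresentation.ClosedSubrep π) {s : H} (hs : s ∈ E) :
    (∫ k, π (ι k) s ∂μK) ∈ E ∧ ∀ k₀, π (ι k₀) (∫ k, π (ι k) s ∂μK) = ∫ k, π (ι k) s ∂μK :=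
  ⟨average_mem ι μK hu hc E hs, apply_average_eq ι μK hu hc s⟩

end Probability

end Summit.HodgeConjecture.HodgeConjecture.Cruxes.H413.K2E1KAverageProjectionU

end
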